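import Literature.MathematicalPhysics.QuantumFieldTheory.Balaban1983to89.B6ZoneKernelsV1
import HarnessLib

/-!
# [B6] Prop. 2.6, line 3 of (2.92): the commutator `[χ, Δ′]` BY PARTS — `[χ, Δ′] = Σ_e (S_e − 1)·c_e + v + V_avg` — and the two inputs
`hbp`, `mGF` of p38's column-zone kernel `B6CommutatorZoneKernels.commZone_right` (the majorant of `G′[χ,Δ′]`)

statement-level skeleton of published theorems with citation tags; proofs where landed; nothing here is a claim about the Yang–Mills mass gap

[tag: formalized_from_source] (construction ours; print p. 238: *"An estimate of the terms with the commutator is even simpler and gives a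
factor O(M⁻¹)"*; (2.67) *"|(G′λ)(x)|, |(∇G′λ)(x)|, |(G′∇*λ)(x)|, … ≦ O(1)[(L^jη)², L^jη, L^jη, …]·e^{−½δ₀d(y,y′)}|λ|"* (its third entry is
used, with the constants renamed `C`, `δ`) [cite: Balaban1984PropagatorsII, (2.67) p.234, p.238].)

## What

On the scalar carrier of ROUTE V (`Δ′ = DpV hN D c = c²(−Δ + avg)`, `B6ScalarFactorsChartV1`):

* §1 the site shift-difference operators `Fsh e` (`e = (μ, +)`: `f(y + e_μ) − f(y)`; `e = (μ, −)`: `f(y − e_μ) − f(y)`), the first-difference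
  coefficients `csχ c χ e` (`c²(χ(y) − χ(y ∓ e_μ))`), the second-difference multiplier `vχ c χ` (`−c²Σ_μ Δ_μχ`), the block-diagonal
  averaging commutator `Vavg = [χ, c²·avg]`, the block-diagonal embeddings `ιB μ`, `ιF μ` of site functions into `μ`-directed bond functions;
* §2 **`Kop_byParts`**: `χΔ′ − Δ′χ = Σ_e (Fsh e)·(csχ e) + vχ + Vavg` — the operator form of `B6ZoneKernelsV1.Kop_apply` with every shift
  moved to the LEFT of its coefficient (`χS_e − S_eχ = (S_e − 1)(S_{−e}χ − χ) + (S_{−e}χ − χ)`), i.e. p38's `hbp` with `F e := Fsh e`,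
  `cs e := csχ e`, `ds e := 0`, `v := vχ`, plus the block-diagonal `V := Vavg`;
* §3 **`hasMajorant_Vavg`**: `Vavg` is block-diagonal with rows in the zone, `|V_avg| ≤ c²·s_b/len²` (block oscillation `s_b` of `χ`, `a_j ≤ 1`);
* §4 **`hasMajorant_mul_Fsh_W`** (p38's `mGF`): for any `T` with the (2.67)₃-leg majorant `C₃·len·e^{−δd′}` of `T∘∂*` on the glued geometry,
  `T·(S_e − 1)` has the majorant `e^{1+δ}K_p(1)·|c|⁻¹C₃·len·e^{−δd′}` for EVERY `e`: backward `e` through the block-diagonal embedding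
  (`S_{−μ} − 1 = c⁻¹·∂*∘ιB μ`), forward `e` (`S_μ − 1 = c⁻¹·∂*∘ιF μ`, whose bond support leaks one site across block faces) by splitting over
  the blocks touching the input block and counting them with the `d_T`-profile `K_p`.

No measure, no Yang–Mills claim.
-/

open scoped BigOperators
open Finset

namespace Literature.MathematicalPhysics.QuantumFieldTheory.Balaban1983to89.B6ZoneByPartsV1

open B4Reflection242 (boxDom)
open B6MultiLevelBoxOperator (N0 levC aPrinted)
open B6MultiLevelTorusOperator (TDomains perLapT)
open B6Geom246MultiLevelBox (bset blkOf)
open B6Geom246MultiLevelTorus (TouchT bondT bondT_adj connectedT touchT_symm)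
open B8Ineq192MultiLevelTorus (geomTB geomTB_len)
open B6Ineq268MultiLevelBox (W)
open B6Ineq288MultiLevelTorus (dP)
open B6RandomWalk (HasMajorant BlockSupp)
open B6RandomWalkHom (HasMajorantHom)
open B6Ineq2133TwoScaleV1 (onFun onFun_apply)
open B6SectAOperatorsV1 (dsE dsE_apply)
open B6Prop26Gluing (mulOp mulOp_apply)
open B6GlobalChartV1 (PV toBox blkV1)
open B6ScalarFactorsChartV1 (chartOp blkS DpV)
open B6AgreeLapV1Chart (apply_eq_sum_toMatrix)
open B6DomainChange (Profile)
open B6Prop25TwoScaleCensus (TSIdx)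
open B6GluedDistWindow (geomW geomW_dist gluedBond connectedW)
open B6ZoneKernelsV1 (Kop_apply avg_entry touchT_blkS_shift distT_le_of_touchT distW_le_of_touchT sum_sameBlk_le levC_W_len levC_nonneg)

variable {d ℓ : ℕ} {m K : ℕ} {hd : 1 ≤ d + 1} {hL : Odd (ℓ + 1) ∧ 1 < ℓ + 1} {Mh k R : ℕ} {P' : Fin (d + 1) → ℕ}
variable (hN : ∀ μ, N0 ℓ Mh k P' μ = (PV d ℓ m K hd hL).sitesPerDir 0) (D : TDomains d ℓ Mh k P' R)

/-! ## §1  The shift-difference operators, the coefficients, the embeddings -/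

section Defs

omit hN D

/-- the shifted site `y ± e_μ` (`e = (μ, +)` or `(μ, −)`). [cite: Balaban1984PropagatorsII, (2.7) p.224, dictionary] -/
def sh (e : Fin (d + 1) × Bool) (y : Site (PV d ℓ m K hd hL) 0) : Site (PV d ℓ m K hd hL) 0 :=
  if e.2 then y.shift e.1 else y.unshift e.1

/-- the oppositely shifted site `y ∓ e_μ`. [cite: Balaban1984PropagatorsII, (2.7) p.224, dictionary] -/
def shInv (e : Fin (d + 1) × Bool) (y : Site (PV d ℓ m K hd hL) 0) : Site (PV d ℓ m K hd hL) 0 :=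
  if e.2 then y.unshift e.1 else y.shift e.1

/-- `sh (μ,+) y = y + e_μ`. [cite: Balaban1984PropagatorsII, (2.7) p.224, dictionary] -/
theorem sh_tt (μ : Fin (d + 1)) (y : Site (PV d ℓ m K hd hL) 0) : sh (μ, true) y = y.shift μ := rfl
/-- `sh (μ,−) y = y − e_μ`. [cite: Balaban1984PropagatorsII, (2.7) p.224, dictionary] -/
theorem sh_ff (μ : Fin (d + 1)) (y : Site (PV d ℓ m K hd hL) 0) : sh (μ, false) y = y.unshift μ := rfl
/-- `shInv (μ,+) y = y − e_μ`. [cite: Balaban1984PropagatorsII, (2.7) p.224, dictionary] -/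
theorem shInv_tt (μ : Fin (d + 1)) (y : Site (PV d ℓ m K hd hL) 0) : shInv (μ, true) y = y.unshift μ := rfl
/-- `shInv (μ,−) y = y + e_μ`. [cite: Balaban1984PropagatorsII, (2.7) p.224, dictionary] -/
theorem shInv_ff (μ : Fin (d + 1)) (y : Site (PV d ℓ m K hd hL) 0) : shInv (μ, false) y = y.shift μ := rfl

/-- `shInv e (sh e y) = y`. [cite: Balaban1984PropagatorsII, (2.7) p.224, dictionary] -/
theorem shInv_sh (e : Fin (d + 1) × Bool) (y : Site (PV d ℓ m K hd hL) 0) : shInv e (sh e y) = y := by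
  obtain ⟨μ, b⟩ := e
  cases b
  · exact B10StarCount.shift_unshift y μ
  · exact B10StarCount.unshift_shift y μ

/-- **the shift-difference operator `S_e − 1`**: `(Fsh e f)(y) = f(y ± e_μ) − f(y)` (p38's `F e`). [cite: Balaban1984PropagatorsII, (2.7) p.224] -/
def Fsh (e : Fin (d + 1) × Bool) : Module.End ℝ (Site (PV d ℓ m K hd hL) 0 → ℝ) where
  toFun f := fun y => f (sh e y) - f y
  map_add' f g := by funext y; simp only [Pi.add_apply]; ring
  map_smul' r f := by funext y; simp only [Pi.smul_apply, smul_eq_mul, RingHom.id_apply]; ring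

/-- `(Fsh e f)(y) = f(y ± e_μ) − f(y)`. [cite: Balaban1984PropagatorsII, (2.7) p.224, dictionary] -/
theorem Fsh_apply (e : Fin (d + 1) × Bool) (f : Site (PV d ℓ m K hd hL) 0 → ℝ) (y : Site (PV d ℓ m K hd hL) 0) :
    Fsh e f y = f (sh e y) - f y := rfl

/-- **the first-difference coefficient** `c_e = c²(χ − S_{−e}χ)`: `csχ c χ e y = c²(χ(y) − χ(y ∓ e_μ))` (p38's `cs e`).
[cite: Balaban1984PropagatorsII, p.238 («the terms with the commutator»); derivation ours] -/
def csχ (c : ℝ) (χ : Site (PV d ℓ m K hd hL) 0 → ℝ) (e : Fin (d + 1) × Bool) (y : Site (PV d ℓ m K hd hL) 0) : ℝ :=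
  c ^ 2 * (χ y - χ (shInv e y))

/-- **the second-difference multiplier** `v = −c²Σ_μ Δ_μχ`. [cite: Balaban1984PropagatorsII, p.238 («the terms with the commutator»); derivation ours] -/
def vχ (c : ℝ) (χ : Site (PV d ℓ m K hd hL) 0 → ℝ) (y : Site (PV d ℓ m K hd hL) 0) : ℝ :=
  -(c ^ 2 * ∑ μ : Fin (d + 1), (χ (y.shift μ) - 2 * χ y + χ (y.unshift μ)))

end Defs

/-- **the block-diagonal averaging commutator** `V_avg = [χ, c²·avg]` (`avg` = the `Q′*aQ′`-part of `Δ′`).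
[cite: Balaban1984PropagatorsII, (2.13)–(2.14) p.225, p.238; derivation ours] -/
noncomputable def Vavg (c : ℝ) (χ : Site (PV d ℓ m K hd hL) 0 → ℝ) : Module.End ℝ (Site (PV d ℓ m K hd hL) 0 → ℝ) :=
  mulOp χ * (c ^ 2 • chartOp hN (dP D - perLapT (N0 ℓ Mh k P'))) - (c ^ 2 • chartOp hN (dP D - perLapT (N0 ℓ Mh k P'))) * mulOp χ

/-- `V_avg` pointwise: `Σ_{x ∼ y} c²·levC·(χ(y) − χ(x))·f(x)`. [cite: Balaban1984PropagatorsII, (2.13)–(2.14) p.225; derivation ours] -/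
theorem Vavg_apply (c : ℝ) (χ f : Site (PV d ℓ m K hd hL) 0 → ℝ) (y : Site (PV d ℓ m K hd hL) 0) :
    Vavg hN D c χ f y = ∑ x, LinearMap.toMatrix' (c ^ 2 • chartOp hN (dP D - perLapT (N0 ℓ Mh k P'))) y x * ((χ y - χ x) * f x) := by
  have e1 : Vavg hN D c χ f y = χ y * (c ^ 2 • chartOp hN (dP D - perLapT (N0 ℓ Mh k P'))) f y -
      (c ^ 2 • chartOp hN (dP D - perLapT (N0 ℓ Mh k P'))) (mulOp χ f) y := rfl
  rw [e1, apply_eq_sum_toMatrix _ f y, apply_eq_sum_toMatrix _ (mulOp χ f) y, Finset.mul_sum, ← Finset.sum_sub_distrib]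
  refine Finset.sum_congr rfl fun x _ => ?_
  rw [mulOp_apply]; ring

section Embeddings

omit hN D

/-- **the block-diagonal embedding `ιB μ`** of a site function as a `μ`-directed bond function at the SOURCE: `(ιB μ f)⟨x, μ⟩ = f(x)`.
[cite: Balaban1984PropagatorsII, (2.8) p.224, dictionary] -/
def ιB (μ : Fin (d + 1)) : (Site (PV d ℓ m K hd hL) 0 → ℝ) →ₗ[ℝ] (PBond (PV d ℓ m K hd hL) 0 → ℝ) where
  toFun f := fun b => if b.dir = μ then f b.src else 0
  map_add' f g := by funext b; simp only [Pi.add_apply]; split_ifs <;> ring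
  map_smul' r f := by funext b; simp only [Pi.smul_apply, smul_eq_mul, RingHom.id_apply]; split_ifs <;> ring

/-- **the forward embedding `ιF μ`**: `(ιF μ f)⟨x, μ⟩ = −f(x + e_μ)` (its bond support leaks one site backwards across block faces).
[cite: Balaban1984PropagatorsII, (2.8) p.224, dictionary] -/
def ιF (μ : Fin (d + 1)) : (Site (PV d ℓ m K hd hL) 0 → ℝ) →ₗ[ℝ] (PBond (PV d ℓ m K hd hL) 0 → ℝ) where
  toFun f := fun b => if b.dir = μ then -f (b.src.shift μ) else 0
  map_add' f g := by funext b; simp only [Pi.add_apply]; split_ifs <;> ring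
  map_smul' r f := by funext b; simp only [Pi.smul_apply, smul_eq_mul, RingHom.id_apply]; split_ifs <;> ring

/-- `(ιB μ f)(b) = [b.dir = μ]·f(b.src)`. [cite: Balaban1984PropagatorsII, (2.8) p.224, dictionary] -/
theorem ιB_apply (μ : Fin (d + 1)) (f : Site (PV d ℓ m K hd hL) 0 → ℝ) (b : PBond (PV d ℓ m K hd hL) 0) :
    ιB μ f b = if b.dir = μ then f b.src else 0 := rfl
/-- `(ιF μ f)(b) = −[b.dir = μ]·f(b.src + e_μ)`. [cite: Balaban1984PropagatorsII, (2.8) p.224, dictionary] -/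
theorem ιF_apply (μ : Fin (d + 1)) (f : Site (PV d ℓ m K hd hL) 0 → ℝ) (b : PBond (PV d ℓ m K hd hL) 0) :
    ιF μ f b = if b.dir = μ then -f (b.src.shift μ) else 0 := rfl

/-- **`S_{−μ} − 1 = c⁻¹·∂*∘ιB μ`**. [cite: Balaban1984PropagatorsII, (2.8) p.224; derivation ours] -/
theorem Fsh_ff_eq (μ : Fin (d + 1)) {c : ℝ} (hc : c ≠ 0) :
    (Fsh (μ, false) : Module.End ℝ (Site (PV d ℓ m K hd hL) 0 → ℝ)) = c⁻¹ • (onFun (dsE (P := PV d ℓ m K hd hL) c) ∘ₗ ιB μ) := by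
  apply LinearMap.ext; intro f; funext y
  rw [Fsh_apply, sh_ff, LinearMap.smul_apply, Pi.smul_apply, LinearMap.comp_apply, onFun_apply, dsE_apply, smul_eq_mul]
  simp only [LatticeFieldCalculus.diverg, smul_eq_mul, ιB_apply]
  rw [Finset.sum_eq_single μ (fun ν _ hν => by rw [if_neg hν, if_neg hν, sub_zero, mul_zero]) (fun h => (h (Finset.mem_univ μ)).elim),
    if_pos rfl, if_pos rfl]
  field_simp

/-- **`S_μ − 1 = c⁻¹·∂*∘ιF μ`**. [cite: Balaban1984PropagatorsII, (2.8) p.224; derivation ours] -/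
theorem Fsh_tt_eq (μ : Fin (d + 1)) {c : ℝ} (hc : c ≠ 0) :
    (Fsh (μ, true) : Module.End ℝ (Site (PV d ℓ m K hd hL) 0 → ℝ)) = c⁻¹ • (onFun (dsE (P := PV d ℓ m K hd hL) c) ∘ₗ ιF μ) := by
  apply LinearMap.ext; intro f; funext y
  rw [Fsh_apply, sh_tt, LinearMap.smul_apply, Pi.smul_apply, LinearMap.comp_apply, onFun_apply, dsE_apply, smul_eq_mul]
  simp only [LatticeFieldCalculus.diverg, smul_eq_mul, ιF_apply]
  rw [Finset.sum_eq_single μ (fun ν _ hν => by rw [if_neg hν, if_neg hν, sub_zero, mul_zero]) (fun h => (h (Finset.mem_univ μ)).elim),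
    if_pos rfl, if_pos rfl]
  have : (y.unshift μ).shift μ = y := B10StarCount.shift_unshift y μ
  rw [this]
  field_simp
  ring

end Embeddings

/-! ## §2  `[χ, Δ′]` by parts -/

section ByParts

/-- **`[χ, Δ′]` BY PARTS**: `χΔ′ − Δ′χ = Σ_{e = (μ,±)} (S_e − 1)·c_e + v + V_avg`, `c_e = c²(χ − S_{−e}χ)`, `v = −c²Σ_μΔ_μχ` — p38's `hbp` with
`F e := Fsh e`, `cs e := csχ c χ e`, `ds e := 0`, `v := vχ c χ`, plus the block-diagonal `Vavg`.
[cite: Balaban1984PropagatorsII, p.238 («the terms with the commutator … O(M⁻¹)»), (2.10) p.225; derivation ours] -/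
theorem Kop_byParts (c : ℝ) (χ : Site (PV d ℓ m K hd hL) 0 → ℝ) :
    mulOp χ * DpV hN D c - DpV hN D c * mulOp χ =
      (∑ e : Fin (d + 1) × Bool, Fsh e * mulOp (csχ c χ e)) + mulOp (vχ c χ) + Vavg hN D c χ := by
  apply LinearMap.ext; intro f; funext y
  rw [Kop_apply hN D c χ f y, LinearMap.add_apply, LinearMap.add_apply, Pi.add_apply, Pi.add_apply, Vavg_apply, mulOp_apply,
    LinearMap.sum_apply, Finset.sum_apply, Fintype.sum_prod_type]
  congr 1
  have e2 : vχ c χ y * f y = ∑ μ : Fin (d + 1), -(c ^ 2 * (χ (y.shift μ) - 2 * χ y + χ (y.unshift μ)) * f y) := by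
    rw [vχ, Finset.mul_sum, neg_mul, Finset.sum_mul, ← Finset.sum_neg_distrib]
  rw [e2, ← Finset.sum_add_distrib]
  refine Finset.sum_congr rfl fun μ _ => ?_
  rw [Fintype.sum_bool, Module.End.mul_apply, Module.End.mul_apply, Fsh_apply, Fsh_apply, mulOp_apply, mulOp_apply, mulOp_apply, mulOp_apply,
    sh_tt, sh_ff]
  simp only [csχ, shInv_tt, shInv_ff, B10StarCount.unshift_shift, B10StarCount.shift_unshift]
  ring

/-- the same with p38's literal summand shape `F e * mulOp (cs e) + mulOp (ds e)`, `ds := 0`.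
[cite: Balaban1984PropagatorsII, p.238; derivation ours] -/
theorem Kop_byParts' (c : ℝ) (χ : Site (PV d ℓ m K hd hL) 0 → ℝ) :
    mulOp χ * DpV hN D c - DpV hN D c * mulOp χ =
      (∑ e ∈ (Finset.univ : Finset (Fin (d + 1) × Bool)), (Fsh e * mulOp (csχ c χ e) + mulOp (fun _ => (0 : ℝ)))) +
        mulOp (vχ c χ) + Vavg hN D c χ := by
  rw [Kop_byParts]
  congr 2
  refine Finset.sum_congr rfl fun e _ => ?_
  have h0 : (mulOp (fun _ : Site (PV d ℓ m K hd hL) 0 => (0 : ℝ)) : Module.End ℝ (Site (PV d ℓ m K hd hL) 0 → ℝ)) = 0 := by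
    apply LinearMap.ext; intro f; funext y; rw [mulOp_apply, zero_mul]; rfl
  rw [h0, add_zero]

/-- the coefficient `c_e` vanishes unless `χ` jumps between `y` and `y ∓ e_μ`. [cite: Balaban1984PropagatorsII, p.238, bookkeeping] -/
theorem csχ_eq_zero {c : ℝ} {χ : Site (PV d ℓ m K hd hL) 0 → ℝ} {e : Fin (d + 1) × Bool} {y : Site (PV d ℓ m K hd hL) 0}
    (h : χ y = χ (shInv e y)) : csχ c χ e y = 0 := by
  rw [csχ, h, sub_self, mul_zero]

/-- `|c_e(y)| = c²·|χ(y) − χ(y ∓ e_μ)|`. [cite: Balaban1984PropagatorsII, p.238, bookkeeping] -/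
theorem abs_csχ (c : ℝ) (χ : Site (PV d ℓ m K hd hL) 0 → ℝ) (e : Fin (d + 1) × Bool) (y : Site (PV d ℓ m K hd hL) 0) :
    |csχ c χ e y| = c ^ 2 * |χ y - χ (shInv e y)| := by
  rw [csχ, abs_mul, abs_of_nonneg (sq_nonneg c)]

/-- `|v(y)| ≤ c²·Σ_μ|Δ_μχ(y)|`. [cite: Balaban1984PropagatorsII, p.238, bookkeeping] -/
theorem abs_vχ_le (c : ℝ) (χ : Site (PV d ℓ m K hd hL) 0 → ℝ) (y : Site (PV d ℓ m K hd hL) 0) :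
    |vχ c χ y| ≤ c ^ 2 * ∑ μ : Fin (d + 1), |χ (y.shift μ) - 2 * χ y + χ (y.unshift μ)| := by
  rw [vχ, abs_neg, abs_mul, abs_of_nonneg (sq_nonneg c)]
  exact mul_le_mul_of_nonneg_left (Finset.abs_sum_le_sum_abs _ _) (sq_nonneg c)

end ByParts

/-! ## §3  The averaging commutator is block-diagonal, rows in the zone, size `c²·s_b/len²` -/

section Avg

/-- **`V_avg` IS BLOCK-DIAGONAL WITH ROWS IN THE ZONE AND SIZE `c²s_b/len²`** — the `V`-slot of p38's `commZone_right_bd` / `commZone_mul`.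
[cite: Balaban1984PropagatorsII, (2.13)–(2.14) p.225, p.238; derivation ours] -/
theorem hasMajorant_Vavg (hℓ : 1 ≤ ℓ) (c : ℝ) (χ : Site (PV d ℓ m K hd hL) 0 → ℝ) (N : Finset ↥(bset D.toDomains)) {sb : ℝ} (hsb : 0 ≤ sb)
    (hb : ∀ x y : Site (PV d ℓ m K hd hL) 0, blkS hN D x = blkS hN D y → |χ x - χ y| ≤ sb)
    (hNb : ∀ y : Site (PV d ℓ m K hd hL) 0, blkS hN D y ∉ N → ∀ x, blkS hN D x = blkS hN D y → χ x = χ y) :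
    HasMajorant (g := geomTB D) (blkS hN D) (Vavg hN D c χ)
      (fun a b => if a = b then (if a ∈ N then c ^ 2 * sb * ((geomTB D).len a ^ 2)⁻¹ else 0) else 0) := by
  classical
  intro y' μ B hμ y
  have hB : 0 ≤ B := hμ.nonneg
  set a : ↥(bset D.toDomains) := blkS hN D y with ha
  have hlen : 0 < (geomTB D).len a := by rw [geomTB_len, mul_one]; positivity
  show |Vavg hN D c χ μ y| ≤ (if a = y' then (if a ∈ N then c ^ 2 * sb * ((geomTB D).len a ^ 2)⁻¹ else 0) else 0) * B
  rw [Vavg_apply]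
  by_cases hay : a = y'
  swap
  · -- off the diagonal block: every term vanishes
    rw [if_neg hay, zero_mul]
    have : ∑ x, LinearMap.toMatrix' (c ^ 2 • chartOp hN (dP D - perLapT (N0 ℓ Mh k P'))) y x * ((χ y - χ x) * μ x) = 0 :=
      Finset.sum_eq_zero fun x _ => by
        by_cases hx : blkS hN D x = blkS hN D y
        · rw [hμ.off x (by rw [hx]; exact hay), mul_zero, mul_zero]
        · rw [avg_entry, if_neg hx, zero_mul]
    rw [this, abs_zero]
  rw [if_pos hay]
  by_cases hyN : a ∈ N
  swap
  · rw [if_neg hyN, zero_mul]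
    have : ∑ x, LinearMap.toMatrix' (c ^ 2 • chartOp hN (dP D - perLapT (N0 ℓ Mh k P'))) y x * ((χ y - χ x) * μ x) = 0 :=
      Finset.sum_eq_zero fun x _ => by
        by_cases hx : blkS hN D x = blkS hN D y
        · rw [hNb y hyN x hx, sub_self, zero_mul, mul_zero]
        · rw [avg_entry, if_neg hx, zero_mul]
    rw [this, abs_zero]
  rw [if_pos hyN]
  have hlevC := levC_nonneg D hℓ a
  have per : ∀ x, |LinearMap.toMatrix' (c ^ 2 • chartOp hN (dP D - perLapT (N0 ℓ Mh k P'))) y x * ((χ y - χ x) * μ x)| ≤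
      (if blkS hN D x = blkS hN D y then (1 : ℝ) else 0) * (c ^ 2 * levC d ℓ (aPrinted ℓ 1) a.1.1 * (sb * B)) := by
    intro x
    rw [avg_entry]
    by_cases hx : blkS hN D x = blkS hN D y
    · rw [if_pos hx, if_pos hx, one_mul, abs_mul, abs_mul, abs_mul, abs_of_nonneg (sq_nonneg c), abs_of_nonneg hlevC]
      have h1 : |χ y - χ x| ≤ sb := by rw [abs_sub_comm]; exact hb x y hx
      have h2 : |μ x| ≤ B := hμ.bound x (by rw [hx]; exact hay)
      exact mul_le_mul_of_nonneg_left (mul_le_mul h1 h2 (abs_nonneg _) hsb) (by positivity)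
    · rw [if_neg hx, if_neg hx, zero_mul, zero_mul, abs_zero]
  calc |∑ x, LinearMap.toMatrix' (c ^ 2 • chartOp hN (dP D - perLapT (N0 ℓ Mh k P'))) y x * ((χ y - χ x) * μ x)|
      ≤ ∑ x, |LinearMap.toMatrix' (c ^ 2 • chartOp hN (dP D - perLapT (N0 ℓ Mh k P'))) y x * ((χ y - χ x) * μ x)| :=
        Finset.abs_sum_le_sum_abs _ _
    _ ≤ ∑ x, (if blkS hN D x = blkS hN D y then (1 : ℝ) else 0) * (c ^ 2 * levC d ℓ (aPrinted ℓ 1) a.1.1 * (sb * B)) :=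
        Finset.sum_le_sum fun x _ => per x
    _ = (∑ x, (if blkS hN D x = blkS hN D y then (1 : ℝ) else 0)) * (c ^ 2 * levC d ℓ (aPrinted ℓ 1) a.1.1 * (sb * B)) := by
        rw [Finset.sum_mul]
    _ ≤ W D.toDomains a * (c ^ 2 * levC d ℓ (aPrinted ℓ 1) a.1.1 * (sb * B)) :=
        mul_le_mul_of_nonneg_right (sum_sameBlk_le hN D y) (by positivity)
    _ = (levC d ℓ (aPrinted ℓ 1) a.1.1 * W D.toDomains a * (geomTB D).len a ^ 2) * (c ^ 2 * sb * ((geomTB D).len a ^ 2)⁻¹ * B) := by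
        field_simp
    _ ≤ 1 * (c ^ 2 * sb * ((geomTB D).len a ^ 2)⁻¹ * B) := mul_le_mul_of_nonneg_right (levC_W_len D hℓ a) (by positivity)
    _ = c ^ 2 * sb * ((geomTB D).len a ^ 2)⁻¹ * B := one_mul _

end Avg

/-! ## §4  The majorant of `T·(S_e − 1)` from the leg `T∘∂*` (p38's `mGF`) -/

section Leg

/-- a block-diagonally embedded site test function is a bond test function on the same block. [cite: Balaban1984PropagatorsII, (2.51) p.232, dictionary] -/
theorem blockSupp_ιB (μd : Fin (d + 1)) {μ : Site (PV d ℓ m K hd hL) 0 → ℝ} {y' : ↥(bset D.toDomains)} {B : ℝ}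
    (hμ : BlockSupp (g := geomTB D) (blkS hN D) μ y' B) : BlockSupp (g := geomTB D) (blkV1 hN D) (ιB μd μ) y' B := by
  refine ⟨hμ.nonneg, fun b hb => ?_, fun b hb => ?_⟩
  · rw [ιB_apply]
    split_ifs
    · exact hμ.bound b.src hb
    · rw [abs_zero]; exact hμ.nonneg
  · rw [ιB_apply]
    split_ifs
    · exact hμ.off b.src hb
    · rfl

/-- `K_p(1) ≥ 1` for a profile of `d_T` (the diagonal term). [cite: Balaban1984PropagatorsII, (2.60) p.234, bookkeeping] -/
theorem one_le_Kp {Kp : ℝ → ℝ} (hPr : Profile (geomTB D).dist (fun a : ↥(bset D.toDomains) => a) Kp)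
    (s : ↥(bset D.toDomains)) : 1 ≤ Kp 1 := by
  classical
  have h := hPr 1 one_pos s
  dsimp only at h
  have hs : Real.exp (-(1 * (geomTB D).dist s s)) = 1 := by
    have : (geomTB D).dist s s = 0 := by
      show (((bondT D).dist s s : ℕ) : ℝ) = 0
      rw [SimpleGraph.dist_self, Nat.cast_zero]
    rw [this, mul_zero, neg_zero, Real.exp_zero]
  have h1 : Real.exp (-(1 * (geomTB D).dist s s)) ≤ ∑ j, Real.exp (-(1 * (geomTB D).dist s j)) :=
    Finset.single_le_sum (f := fun j => Real.exp (-(1 * (geomTB D).dist s j))) (fun j _ => (Real.exp_pos _).le) (Finset.mem_univ s)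
  calc (1 : ℝ) = Real.exp (-(1 * (geomTB D).dist s s)) := hs.symm
    _ ≤ ∑ j, Real.exp (-(1 * (geomTB D).dist s j)) := h1
    _ ≤ Kp 1 := h

open Classical in
/-- the number of blocks touching a block is `≤ e·K_p(1)`. [cite: Balaban1984PropagatorsII, (2.46) p.231, (2.60) p.234; derivation ours] -/
theorem card_touch_le (hMh : 1 ≤ Mh) (hP : ∀ μ, 1 ≤ P' μ) {Kp : ℝ → ℝ} (hPr : Profile (geomTB D).dist (fun a : ↥(bset D.toDomains) => a) Kp)
    (y' : ↥(bset D.toDomains)) :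
    ∑ b'' : ↥(bset D.toDomains), (if TouchT D b'' y' then (1 : ℝ) else 0) ≤ Real.exp 1 * Kp 1 := by
  have h := hPr 1 one_pos y'
  dsimp only at h
  calc ∑ b'' : ↥(bset D.toDomains), (if TouchT D b'' y' then (1 : ℝ) else 0)
      ≤ ∑ b'', Real.exp 1 * Real.exp (-(1 * (geomTB D).dist y' b'')) := by
        refine Finset.sum_le_sum fun b'' _ => ?_
        split_ifs with ht
        · have hd1 : (geomTB D).dist y' b'' ≤ 1 := by
            have := distT_le_of_touchT D hMh hP (touchT_symm ht) b''
            have h0 : (geomTB D).dist b'' b'' = 0 := by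
              show (((bondT D).dist b'' b'' : ℕ) : ℝ) = 0
              rw [SimpleGraph.dist_self, Nat.cast_zero]
            linarith
          rw [← Real.exp_add]
          exact Real.one_le_exp_iff.2 (by linarith)
        · positivity
    _ = Real.exp 1 * ∑ b'', Real.exp (-(1 * (geomTB D).dist y' b'')) := by rw [Finset.mul_sum]
    _ ≤ Real.exp 1 * Kp 1 := mul_le_mul_of_nonneg_left h (Real.exp_pos _).le

/-- **`T·(S_e − 1)` HAS THE MAJORANT `e^{1+δ}K_p(1)·|c|⁻¹C₃·len·e^{−δρ}`** (p38's `mGF`, every `e`), for any `T` whose leg `T∘∂*` has the (2.67)₃-type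
majorant `C₃·len·e^{−δρ}` (any row distance `ρ` with `ρ(a,b) ≤ ρ(a,b″) + 1` for `b″` touching `b`): backward `e` through `ιB`, forward `e`
through `ιF` split over the `≤ e·K_p(1)` blocks touching the input block. [cite: Balaban1984PropagatorsII, (2.67) p.234, p.238; derivation ours] -/
theorem hasMajorant_mul_Fsh (hMh : 1 ≤ Mh) (hP : ∀ μ, 1 ≤ P' μ) {c : ℝ} (hc : c ≠ 0)
    (ρ : ↥(bset D.toDomains) → ↥(bset D.toDomains) → ℝ) (hρ : ∀ a b b'', TouchT D b'' b → ρ a b ≤ ρ a b'' + 1)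
    {Kp : ℝ → ℝ} (hPr : Profile (geomTB D).dist (fun a : ↥(bset D.toDomains) => a) Kp)
    (T : Module.End ℝ (Site (PV d ℓ m K hd hL) 0 → ℝ)) {C₃ δ : ℝ} (hC₃ : 0 ≤ C₃) (hδ : 0 ≤ δ)
    (mTE : HasMajorantHom (g := geomTB D) (blkV1 hN D) (blkS hN D) (T ∘ₗ onFun (dsE (P := PV d ℓ m K hd hL) c))
      (fun a b => C₃ * (geomTB D).len a * Real.exp (-(δ * ρ a b))))
    (e : Fin (d + 1) × Bool) :
    HasMajorant (g := geomTB D) (blkS hN D) (T * Fsh e)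
      (fun a b => Real.exp (1 + δ) * Kp 1 * |c|⁻¹ * C₃ * (geomTB D).len a * Real.exp (-(δ * ρ a b))) := by
  classical
  intro y' μ B hμ x
  dsimp only
  have hB : 0 ≤ B := hμ.nonneg
  have hKp : 1 ≤ Kp 1 := one_le_Kp D hPr y'
  have hlen : 0 < (geomTB D).len (blkS hN D x) := by rw [geomTB_len, mul_one]; positivity
  set a := blkS hN D x with ha
  set E := Real.exp (-(δ * ρ a y')) with hE
  have hE0 : 0 < E := Real.exp_pos _
  obtain ⟨μd, sgn⟩ := e
  cases sgn
  · -- backward: `S_{−μ} − 1 = c⁻¹·∂*∘ιB μ`, one block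
    have e1 : (T * Fsh (μd, false) : Module.End ℝ (Site (PV d ℓ m K hd hL) 0 → ℝ)) μ x =
        c⁻¹ * (T ∘ₗ onFun (dsE (P := PV d ℓ m K hd hL) c)) (ιB μd μ) x := by
      rw [Module.End.mul_apply, Fsh_ff_eq μd hc, LinearMap.smul_apply, map_smul, Pi.smul_apply, smul_eq_mul, LinearMap.comp_apply,
        LinearMap.comp_apply]
    rw [e1, abs_mul, abs_inv]
    have h1 := mTE y' (ιB μd μ) B (blockSupp_ιB hN D μd hμ) x
    calc |c|⁻¹ * |(T ∘ₗ onFun (dsE (P := PV d ℓ m K hd hL) c)) (ιB μd μ) x| ≤ |c|⁻¹ * (C₃ * (geomTB D).len a * E * B) :=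
          mul_le_mul_of_nonneg_left h1 (by positivity)
      _ = 1 * 1 * (|c|⁻¹ * C₃ * (geomTB D).len a * E * B) := by ring
      _ ≤ Real.exp (1 + δ) * Kp 1 * (|c|⁻¹ * C₃ * (geomTB D).len a * E * B) := by
          refine mul_le_mul_of_nonneg_right (mul_le_mul (Real.one_le_exp_iff.2 (by linarith)) hKp zero_le_one (Real.exp_pos _).le)
            (by positivity)
      _ = Real.exp (1 + δ) * Kp 1 * |c|⁻¹ * C₃ * (geomTB D).len a * E * B := by ring
  · -- forward: `S_μ − 1 = c⁻¹·∂*∘ιF μ`, split over the blocks touching `y′`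
    have e1 : (T * Fsh (μd, true) : Module.End ℝ (Site (PV d ℓ m K hd hL) 0 → ℝ)) μ x =
        c⁻¹ * (T ∘ₗ onFun (dsE (P := PV d ℓ m K hd hL) c)) (ιF μd μ) x := by
      rw [Module.End.mul_apply, Fsh_tt_eq μd hc, LinearMap.smul_apply, map_smul, Pi.smul_apply, smul_eq_mul, LinearMap.comp_apply,
        LinearMap.comp_apply]
    -- the pieces `A_{b″} = ιF μ·1_{blkV1 = b″}`
    set A : ↥(bset D.toDomains) → PBond (PV d ℓ m K hd hL) 0 → ℝ := fun b'' b => if blkV1 hN D b = b'' then ιF μd μ b else 0 with hA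
    have hsplit : ιF μd μ = ∑ b'' : ↥(bset D.toDomains), A b'' := by
      funext b
      rw [Finset.sum_apply, Finset.sum_eq_single (blkV1 hN D b) (fun b'' _ hne => by rw [hA]; simp only; rw [if_neg (Ne.symm hne)])
        (fun h => (h (Finset.mem_univ _)).elim)]
      simp only [hA, if_pos rfl]
    -- each piece is block-supported; it vanishes unless its block touches `y′`
    have hAsupp : ∀ b'', BlockSupp (g := geomTB D) (blkV1 hN D) (A b'') b'' B := by
      intro b''
      refine ⟨hB, fun b hb => ?_, fun b hb => ?_⟩
      · simp only [hA]
        split_ifs with h1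
        · rw [ιF_apply]
          split_ifs with h2
          · rw [abs_neg]
            by_cases hs : blkS hN D (b.src.shift μd) = y'
            · exact hμ.bound _ hs
            · rw [hμ.off _ hs, abs_zero]; exact hB
          · rw [abs_zero]; exact hB
        · rw [abs_zero]; exact hB
      · simp only [hA]
        split_ifs with h1
        · exact absurd h1 hb
        · rfl
    have hAzero : ∀ b'', ¬ TouchT D b'' y' → A b'' = 0 := by
      intro b'' ht
      funext b
      simp only [hA, Pi.zero_apply]
      split_ifs with hb
      · rw [ιF_apply]
        split_ifs with hdir
        · have hs : blkS hN D (b.src.shift μd) ≠ y' := by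
            intro hs
            apply ht
            rw [← hb, ← hs]
            exact touchT_blkS_shift hN D hMh hP b.src μd
          rw [hμ.off _ hs, neg_zero]
        · rfl
      · rfl
    -- the bound piece by piece
    have hterm : ∀ b'', |(T ∘ₗ onFun (dsE (P := PV d ℓ m K hd hL) c)) (A b'') x| ≤
        (if TouchT D b'' y' then (1 : ℝ) else 0) * (C₃ * (geomTB D).len a * (Real.exp δ * E) * B) := by
      intro b''
      by_cases ht : TouchT D b'' y'
      · rw [if_pos ht, one_mul]
        have h1 := mTE b'' (A b'') B (hAsupp b'') x
        have hρ' : ρ a y' ≤ ρ a b'' + 1 := hρ a y' b'' ht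
        have hexp : Real.exp (-(δ * ρ a b'')) ≤ Real.exp δ * E := by
          rw [hE, ← Real.exp_add]; exact Real.exp_le_exp.2 (by nlinarith)
        exact h1.trans (by
          have : C₃ * (geomTB D).len a * Real.exp (-(δ * ρ a b'')) * B ≤ C₃ * (geomTB D).len a * (Real.exp δ * E) * B :=
            mul_le_mul_of_nonneg_right (mul_le_mul_of_nonneg_left hexp (by positivity)) hB
          exact this)
      · rw [if_neg ht, zero_mul, hAzero b'' ht, map_zero, Pi.zero_apply, abs_zero]
    rw [e1, abs_mul, abs_inv, hsplit, map_sum, Finset.sum_apply]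
    calc |c|⁻¹ * |∑ b'', (T ∘ₗ onFun (dsE (P := PV d ℓ m K hd hL) c)) (A b'') x|
        ≤ |c|⁻¹ * ∑ b'', |(T ∘ₗ onFun (dsE (P := PV d ℓ m K hd hL) c)) (A b'') x| :=
          mul_le_mul_of_nonneg_left (Finset.abs_sum_le_sum_abs _ _) (by positivity)
      _ ≤ |c|⁻¹ * ∑ b'', (if TouchT D b'' y' then (1 : ℝ) else 0) * (C₃ * (geomTB D).len a * (Real.exp δ * E) * B) :=
          mul_le_mul_of_nonneg_left (Finset.sum_le_sum fun b'' _ => hterm b'') (by positivity)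
      _ = |c|⁻¹ * ((∑ b'', (if TouchT D b'' y' then (1 : ℝ) else 0)) * (C₃ * (geomTB D).len a * (Real.exp δ * E) * B)) := by
          rw [Finset.sum_mul]
      _ ≤ |c|⁻¹ * ((Real.exp 1 * Kp 1) * (C₃ * (geomTB D).len a * (Real.exp δ * E) * B)) :=
          mul_le_mul_of_nonneg_left (mul_le_mul_of_nonneg_right (card_touch_le D hMh hP hPr y') (by positivity)) (by positivity)
      _ = Real.exp (1 + δ) * Kp 1 * |c|⁻¹ * C₃ * (geomTB D).len a * E * B := by rw [Real.exp_add]; ring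

/-- **p38's `mGF` ON p21's TORUS GEOMETRY** (`ρ = d_T`). [cite: Balaban1984PropagatorsII, (2.67) p.234, p.238; derivation ours] -/
theorem hasMajorant_mul_Fsh_T (hMh : 1 ≤ Mh) (hP : ∀ μ, 1 ≤ P' μ) {c : ℝ} (hc : c ≠ 0)
    {Kp : ℝ → ℝ} (hPr : Profile (geomTB D).dist (fun a : ↥(bset D.toDomains) => a) Kp)
    (T : Module.End ℝ (Site (PV d ℓ m K hd hL) 0 → ℝ)) {C₃ δ : ℝ} (hC₃ : 0 ≤ C₃) (hδ : 0 ≤ δ)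
    (mTE : HasMajorantHom (g := geomTB D) (blkV1 hN D) (blkS hN D) (T ∘ₗ onFun (dsE (P := PV d ℓ m K hd hL) c))
      (fun a b => C₃ * (geomTB D).len a * Real.exp (-(δ * (geomTB D).dist a b))))
    (e : Fin (d + 1) × Bool) :
    HasMajorant (g := geomTB D) (blkS hN D) (T * Fsh e)
      (fun a b => Real.exp (1 + δ) * Kp 1 * |c|⁻¹ * C₃ * (geomTB D).len a * Real.exp (-(δ * (geomTB D).dist a b))) :=
  hasMajorant_mul_Fsh hN D hMh hP hc (fun a b => (geomTB D).dist a b) (fun a b b'' h => by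
      have h1 := distT_le_of_touchT D hMh hP (touchT_symm h) a
      have hs : ∀ u v : ↥(bset D.toDomains), (geomTB D).dist u v = (geomTB D).dist v u := fun u v => by
        show (((bondT D).dist u v : ℕ) : ℝ) = (((bondT D).dist v u : ℕ) : ℝ); rw [SimpleGraph.dist_comm]
      rw [hs a b, hs a b'']; exact h1)
    hPr T hC₃ hδ mTE e

variable {a₀ a₁ : ℝ} {t : TSIdx d (ℓ + 1) hd hL a₀ a₁} {x₀ : Fin (d + 1) → ℤ}
variable (hx₀ : ∀ μ, 0 ≤ x₀ μ) (hfit : ∀ μ, x₀ μ + (t.P.sitesPerDir 0 : ℕ) ≤ ((PV d ℓ m K hd hL).sitesPerDir 0 : ℕ))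
variable {Mh₁ k₁ R₁ : ℕ} {P₁ : Fin (d + 1) → ℕ}
variable (hN₁ : ∀ μ, N0 ℓ Mh₁ k₁ P₁ μ = (PV d ℓ t.m t.K hd hL).sitesPerDir 0) (D₁ : TDomains d ℓ Mh₁ k₁ P₁ R₁)

/-- **p38's `mGF` ON THE GLUED GEOMETRY** (`ρ = d′`; the count still uses the `d_T`-profile). [cite: Balaban1984PropagatorsII, (2.67) p.234, p.238, p.238–239 (T_□); derivation ours] -/
theorem hasMajorant_mul_Fsh_W (hMh : 1 ≤ Mh) (hP : ∀ μ, 1 ≤ P' μ) {c : ℝ} (hc : c ≠ 0)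
    {Kp : ℝ → ℝ} (hPr : Profile (geomTB D).dist (fun a : ↥(bset D.toDomains) => a) Kp)
    (T : Module.End ℝ (Site (PV d ℓ m K hd hL) 0 → ℝ)) {C₃ δ : ℝ} (hC₃ : 0 ≤ C₃) (hδ : 0 ≤ δ)
    (mTE : HasMajorantHom (g := geomW hN D hx₀ hfit hN₁ D₁) (blkV1 hN D) (blkS hN D) (T ∘ₗ onFun (dsE (P := PV d ℓ m K hd hL) c))
      (fun a b => C₃ * (geomW hN D hx₀ hfit hN₁ D₁).len a * Real.exp (-(δ * (geomW hN D hx₀ hfit hN₁ D₁).dist a b))))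
    (e : Fin (d + 1) × Bool) :
    HasMajorant (g := geomW hN D hx₀ hfit hN₁ D₁) (blkS hN D) (T * Fsh e)
      (fun a b => Real.exp (1 + δ) * Kp 1 * |c|⁻¹ * C₃ * (geomW hN D hx₀ hfit hN₁ D₁).len a *
        Real.exp (-(δ * (geomW hN D hx₀ hfit hN₁ D₁).dist a b))) := by
  have key := hasMajorant_mul_Fsh hN D hMh hP hc (fun a b => (geomW hN D hx₀ hfit hN₁ D₁).dist a b) (fun a b b'' h => by
      have h1 := distW_le_of_touchT hN D hMh hP hx₀ hfit hN₁ D₁ (touchT_symm h) a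
      have hs : ∀ u v : ↥(bset D.toDomains), (geomW hN D hx₀ hfit hN₁ D₁).dist u v = (geomW hN D hx₀ hfit hN₁ D₁).dist v u :=
        fun u v => by rw [geomW_dist, geomW_dist, SimpleGraph.dist_comm]
      rw [hs a b, hs a b'']; exact h1)
    hPr T hC₃ hδ (fun y' A B hA x => mTE y' A B ⟨hA.nonneg, hA.bound, hA.off⟩ x) e
  intro y' μ B hμ x
  exact key y' μ B ⟨hμ.nonneg, hμ.bound, hμ.off⟩ x

end Leg

/-! ## §5  The global `G′·(S_e − 1)` on the glued geometry with the constants of `factors_V1_TB` (p38's `mGF` for `G := GpV`) -/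

section GlobalGF

/-- **p38's `mGF` FOR THE GLOBAL `G′ = GpV hN D c`** on the glued geometry of any window, with the constant triple `M₁, δ, C` of
`B6ScalarFactorsChartV1.factors_V1_TB` and the `d_T`-profile `K_p`: `G′·(S_e − 1)` has the majorant
`e^{1+δ}K_p(1)·|c|⁻¹·((d+1)|c|⁻¹C)·len·e^{−δd′}` for every `e`. [cite: Balaban1984PropagatorsII, (2.67) p.234, p.238; derivation ours] -/
theorem global_mGF (d ℓ : ℕ) (hd : 1 ≤ d + 1) (hL : Odd (ℓ + 1) ∧ 1 < ℓ + 1) :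
    ∃ M₁ δ C : ℝ, 0 < M₁ ∧ 0 < δ ∧ 0 < C ∧
      ∀ (m K : ℕ) {Mh k R : ℕ} {P' : Fin (d + 1) → ℕ} (hN : ∀ μ, N0 ℓ Mh k P' μ = (PV d ℓ m K hd hL).sitesPerDir 0)
        (D : TDomains d ℓ Mh k P' R) {a₀ a₁ : ℝ} {t : TSIdx d (ℓ + 1) hd hL a₀ a₁} {x₀ : Fin (d + 1) → ℤ}
        (hx₀ : ∀ μ, 0 ≤ x₀ μ) (hfit : ∀ μ, x₀ μ + (t.P.sitesPerDir 0 : ℕ) ≤ ((PV d ℓ m K hd hL).sitesPerDir 0 : ℕ))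
        {Mh₁ k₁ R₁ : ℕ} {P₁ : Fin (d + 1) → ℕ} (hN₁ : ∀ μ, N0 ℓ Mh₁ k₁ P₁ μ = (PV d ℓ t.m t.K hd hL).sitesPerDir 0)
        (D₁ : TDomains d ℓ Mh₁ k₁ P₁ R₁) {Kp : ℝ → ℝ},
        Profile (geomTB D).dist (fun a : ↥(bset D.toDomains) => a) Kp →
        (∀ μ, 4 ≤ P' μ) → 2 * (ℓ + 1) ≤ R → M₁ ≤ ((ℓ : ℝ) + 1) * Mh →
        ∀ {c : ℝ}, c ≠ 0 → ∀ e : Fin (d + 1) × Bool,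
          HasMajorant (g := geomW hN D hx₀ hfit hN₁ D₁) (blkS hN D) (B6ScalarFactorsChartV1.GpV hN D c * Fsh e)
            (fun a b => Real.exp (1 + δ) * Kp 1 * |c|⁻¹ * (((d : ℝ) + 1) * |c|⁻¹ * C) * (geomW hN D hx₀ hfit hN₁ D₁).len a *
              Real.exp (-(δ * (geomW hN D hx₀ hfit hN₁ D₁).dist a b))) := by
  obtain ⟨M₁, δ, C, hM₁, hδ, hC, hfac⟩ := B6ScalarFactorsChartV1.factors_V1_TB d ℓ hd hL
  refine ⟨M₁, δ, C, hM₁, hδ, hC, ?_⟩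
  intro m K Mh k R P' hN D a₀ a₁ t x₀ hx₀ hfit Mh₁ k₁ R₁ P₁ hN₁ D₁ Kp hPr hP4 hR hM c hc e
  have hP1 : ∀ μ, 1 ≤ P' μ := fun μ => le_trans (by norm_num) (hP4 μ)
  have hMh1 : 1 ≤ Mh := by
    by_contra h0
    have : Mh = 0 := by omega
    rw [this, Nat.cast_zero, mul_zero] at hM
    linarith
  obtain ⟨-, -, h3, -⟩ := hfac m K hN D hP4 hR hM hc
  have h3W := B6ZoneKernelsV1.hasMajorantHom_glob_W_YS hN D hx₀ hfit hN₁ D₁ hMh1 hP1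
    (φ := fun y => ((d : ℝ) + 1) * |c|⁻¹ * C * (geomTB D).len y) (fun y => by rw [geomTB_len]; positivity) hδ.le h3
  exact hasMajorant_mul_Fsh_W hN D hx₀ hfit hN₁ D₁ hMh1 hP1 hc hPr (B6ScalarFactorsChartV1.GpV hN D c) (C₃ := ((d : ℝ) + 1) * |c|⁻¹ * C)
    (by positivity) hδ.le h3W e

end GlobalGF

end Literature.MathematicalPhysics.QuantumFieldTheory.Balaban1983to89.B6ZoneByPartsV1
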